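import Summits.CriticalPhenomena.PercolationContinuityZ3.Theorems.PercNearOneGluingNoHeavyLowerTailQ7Three
import HarnessLib

/-!
# `NoHeavyLowerTail` (stmt-CriticalPhenomena-4575) — the SPECTATOR EXCHANGE: Kozma–Nitzan's gluing inequality (9)
# with a spectator vertex, in the direction of the weakest endpoint

Support file (lemma factory `prim-lf-3` gen 11, seat g11; `--supports stmt-CriticalPhenomena-4575`).  No definitions, no
named facts, no sorries.  Memo: `run/shared/lean/prim/prim-lf-3/LF3-BETA-R.md` §16 (regime II / A″ of the formal face of the
`2 + (any law)` kernel, `twoPortSide_reduction`; the atom inequality Φ of `prim-nh-lead-4575/LEAD-GEN11` §3h).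

Setting: any finite weighted graph `w`, a target `b`, a pair `A = {p, p′}` (to be glued), a spectator `j` and a further vertex
`z`.  Kozma–Nitzan's reformulation (9) of their Lemma 4 (arXiv:2401.12397, pp. 9–10) reads
`P(A↔b, z↮b, z≁A) − P(z↔b, A↮b) ≥ min(P(p↔b), P(p′↔b)) − P(z↔b)`.  With a spectator `j` the corresponding display is

  `P(A↔b, z ≁ {b,p,p′,j}) − P(z↔b, A↮b, j↔A) ≥ min(P(p↔b), P(p′↔b), P(j↔b)) − P(z↔b)`,

and this file proves it when the minimum is attained at an endpoint `p` of the pair (`spectatorExchange`):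
if `P(p↔b) ≤ P(p′↔b)` and `P(p↔b) ≤ P(j↔b)` then

  `P(p↔b) − P(z↔b) ≤ P((p↔b ∪ p′↔b), z↮b, z↮p, z↮p′, z↮j) − P(z↔b, p↮b, p′↮b, (j↔p ∪ j↔p′))`.

Read through the glued pair (`M = w[s(p,p′) ↦ 1]`, `X = [pp′]`) the right side is `μ_M(X↔b, z↮b, j↮z) − μ_M(z↔b, X↮b, j↔X)`, the
difference of the gains of `z` and of `j` when `X` and `z` are merged; so the lemma says that this gain difference is at least
`P(p↔b) − P(z↔b)` whenever `p` is the least `b`-reliable of `p, p′, j` — the anchored exchange `anchoredExchange` gives `≥ 0` under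
`z ≤ j` instead.  Proof: Kozma–Nitzan's Question 7 for the three relays `{p, p′, j}` with observer `z` and designated relay `p`
(`Q7Psi.q7_three`, coupling seat, unconditional): `μ(p↔b, z↔{p,p′,j}) ≤ μ(z↔b, z↔{p,p′,j})`; off the event `{z↔{p,p′,j}}` the two
inclusions `{p↔b} ⊆ {A↔b, z ≁ b,p,p′,j}` and `{z↔b, A↮b, j↔A} ⊆ {z↔b}` finish.
-/

namespace Summit.CriticalPhenomena.PercolationContinuityZ3.Theorems

open MeasureTheory Set Literature.Probability.LatticeModels Literature.Probability.Percolation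
open scoped Classical

noncomputable section

namespace UpsetExchange

universe u

variable {V : Type u} [Fintype V]

/-- **Spectator exchange** (KN's (9) with a spectator, weakest-endpoint direction).  See the module docstring.
[cite: KozmaNitzan2024, Lemma 4 and (9) (pp. 9–10), Question 7 (p. 36)] -/
theorem spectatorExchange (w : Sym2 V → unitInterval) (b z j p p' : V)
    (hzb : z ≠ b) (hpb : p ≠ b) (hp'b : p' ≠ b) (hjb : j ≠ b) (hpp' : p ≠ p') (hpj : p ≠ j) (hp'j : p' ≠ j)
    (hle₁ : (prodBernoulli w).real (openConn p b) ≤ (prodBernoulli w).real (openConn p' b))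
    (hle₂ : (prodBernoulli w).real (openConn p b) ≤ (prodBernoulli w).real (openConn j b)) :
    (prodBernoulli w).real (openConn p b) - (prodBernoulli w).real (openConn z b) ≤
      (prodBernoulli w).real ((openConn p b ∪ openConn p' b) ∩ (openConn z b)ᶜ ∩ (openConn z p)ᶜ ∩
          (openConn z p')ᶜ ∩ (openConn z j)ᶜ) -
        (prodBernoulli w).real (openConn z b ∩ (openConn p b)ᶜ ∩ (openConn p' b)ᶜ ∩ (openConn j p ∪ openConn j p')) := by
  set μ := prodBernoulli w with hμ
  have hmeas : ∀ X : Set (BondConfig V), MeasurableSet X := fun _ => MeasurableSet.of_discrete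
  -- the observer event of `z` towards the three relays `p', j, p`
  set U : Set (BondConfig V) := openConn z p' ∪ openConn z j ∪ openConn z p with hU
  -- Question 7 for three relays, observer `z`, designated relay `p`
  have hq7 : μ.real (openConn p b ∩ U) ≤ μ.real (openConn z b ∩ U) :=
    Q7Psi.q7_three w z b p' j p hzb hp'b hjb hpb hp'j hpp'.symm hpj.symm hle₁ hle₂
  -- split both reliabilities along `U`
  have hsp := measureReal_inter_add_sdiff (μ := μ) (s := openConn p b) (hmeas U) (measure_ne_top _ _)
  have hsz := measureReal_inter_add_sdiff (μ := μ) (s := openConn z b) (hmeas U) (measure_ne_top _ _)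
  -- off `U`: `{p↔b} ⊆ {A↔b, z ≁ b,p,p',j}`
  have h1 : μ.real (openConn p b \ U) ≤
      μ.real ((openConn p b ∪ openConn p' b) ∩ (openConn z b)ᶜ ∩ (openConn z p)ᶜ ∩ (openConn z p')ᶜ ∩ (openConn z j)ᶜ) := by
    apply measureReal_mono
    · rintro ω ⟨hpbω, hUω⟩
      simp only [hU, mem_union, not_or] at hUω
      obtain ⟨⟨hzp', hzj⟩, hzp⟩ := hUω
      refine ⟨⟨⟨⟨Or.inl hpbω, fun hzbω => hzp ?_⟩, hzp⟩, hzp'⟩, hzj⟩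
      exact (hzbω : (openGraph ω).Reachable z b).trans (hpbω : (openGraph ω).Reachable p b).symm
    · exact measure_ne_top _ _
  -- off `U`: `{z↔b, A↮b, j↔A} ⊆ {z↔b} \ U`
  have h2 : μ.real (openConn z b ∩ (openConn p b)ᶜ ∩ (openConn p' b)ᶜ ∩ (openConn j p ∪ openConn j p')) ≤
      μ.real (openConn z b \ U) := by
    apply measureReal_mono
    · rintro ω ⟨⟨⟨hzbω, hpbω⟩, hp'bω⟩, hjA⟩
      refine ⟨hzbω, ?_⟩
      simp only [hU, mem_union, not_or]
      refine ⟨⟨fun hzp' => hp'bω ?_, fun hzj => ?_⟩, fun hzp => hpbω ?_⟩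
      · exact (hzp' : (openGraph ω).Reachable z p').symm.trans (hzbω : (openGraph ω).Reachable z b)
      · rcases hjA with hjp | hjp'
        · exact hpbω (((hjp : (openGraph ω).Reachable j p).symm.trans
            (hzj : (openGraph ω).Reachable z j).symm).trans (hzbω : (openGraph ω).Reachable z b))
        · exact hp'bω (((hjp' : (openGraph ω).Reachable j p').symm.trans
            (hzj : (openGraph ω).Reachable z j).symm).trans (hzbω : (openGraph ω).Reachable z b))
      · exact (hzp : (openGraph ω).Reachable z p).symm.trans (hzbω : (openGraph ω).Reachable z b)
    · exact measure_ne_top _ _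
  linarith

/-- **Spectator exchange, gain form.**  Under the same hypotheses, with the gains read as in the module docstring:
`P(z↔b, A↮b, j↔A) + P(p↔b) ≤ P(A↔b, z ≁ b,p,p′,j) + P(z↔b)`. [cite: KozmaNitzan2024, (9) (pp. 9–10), Question 7 (p. 36)] -/
theorem spectatorExchange' (w : Sym2 V → unitInterval) (b z j p p' : V)
    (hzb : z ≠ b) (hpb : p ≠ b) (hp'b : p' ≠ b) (hjb : j ≠ b) (hpp' : p ≠ p') (hpj : p ≠ j) (hp'j : p' ≠ j)
    (hle₁ : (prodBernoulli w).real (openConn p b) ≤ (prodBernoulli w).real (openConn p' b))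
    (hle₂ : (prodBernoulli w).real (openConn p b) ≤ (prodBernoulli w).real (openConn j b)) :
    (prodBernoulli w).real (openConn z b ∩ (openConn p b)ᶜ ∩ (openConn p' b)ᶜ ∩ (openConn j p ∪ openConn j p')) +
        (prodBernoulli w).real (openConn p b) ≤
      (prodBernoulli w).real ((openConn p b ∪ openConn p' b) ∩ (openConn z b)ᶜ ∩ (openConn z p)ᶜ ∩
          (openConn z p')ᶜ ∩ (openConn z j)ᶜ) + (prodBernoulli w).real (openConn z b) := by
  have h := spectatorExchange w b z j p p' hzb hpb hp'b hjb hpp' hpj hp'j hle₁ hle₂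
  linarith

end UpsetExchange

end

end Summit.CriticalPhenomena.PercolationContinuityZ3.Theorems
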